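import Literature.LinearAlgebra.InvariantSubspaceLatticeInclusion
import Literature.LinearAlgebra.InvariantSubspaceLatticeDistributive
import HarnessLib

/-!
# The invariant subspace lattice of a PRIMARY transformation (Brickman–Fillmore 1967, Lemmas 3 (a), 4 and 5, §3 item 1, the
# argument of Theorem 9): covers in `L(A)` raise the dimension by `d = deg p`, every member has dimension divisible by `d` and
# every multiple of `d` occurs, `p(A)⁻¹M ∈ L(A)`, `L(A)` is irreducible iff `A` is primary, the socle `Ker p(A)` and the socle
# series `Ker p(A)ʲ` are lattice-intrinsic, `A` is cyclic iff `dim Ker p(A) ≤ d`, and `F[A]` is a field iff `m_A` is irreducible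

[topic LinearAlgebra]

Topic `Literature/LinearAlgebra` (namespace `Literature.LinearAlgebra`), lane `lit-hodgefound` (Track 2 foundations library;
prover seat `lit-hodgefound-p34`, generation 48, row g48-#3). THEOREMS ONLY (no definition, no instance, no notation, no named
fact; net debt `0`). Sequel of `Literature.LinearAlgebra.NilpotentInvariantSubspaceLattice` (§2 there: Lemma 4 for a NILPOTENT
`Q`, `d = 1`) and `Literature.LinearAlgebra.InvariantSubspaceLatticeDirectSum` (Lemma 1, and Theorem 1's clause «each `L(A_t)`
is irreducible»). `L(A)` is Mathlib's `Module.End.invtSubmodule A`; "`A` is `p`-primary" is rendered by `m_A ∣ pⁿ` (`p` monic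
irreducible) or, where [BF67] need the exact statement, `m_A = pⁿ`; "`N` covers `M`" is unfolded (as in the nilpotent file)
as `M < N` in `L(A)` with no member of `L(A)` strictly between, and restated with Mathlib's `CovBy` on `↥L(A)`.

## Source, VERBATIM ([BF67] L. Brickman, P. A. Fillmore, *The invariant subspace lattice of a linear transformation*, Canad. J.
Math. 19 (1967) 810–822; held text `paper:doi-10-4153-cjm-1967-075-4`)

* p. 811: «If the minimum polynomial `m_A` of `A` is a power of an irreducible polynomial `p`, then `A` is called primary
  (or `p`-primary)»; §1: «A lattice that cannot be written as a direct sum (except trivially) will be called irreducible.»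
* **Lemma 4** (p. 813): «Let `A` be `p`-primary, and let `d = deg p`. If `M, N ∈ L(A)` and `N` covers `M`, then
  (a) `p(A)N ⊂ M`, (b) `dim N = d + dim M`. Consequently (c) `d | dim M` for every `M ∈ L(A)`.» Proof: «Let `A′` be the
  quotient transformation induced by `A` on `V/M`. Then `N′ = N/M` is a minimal non-zero element of `L(A′)`. But
  `p(A′)N′ ⊂ N′` and `p(A′)N′ ∈ L(A′)`. Since `p(A′)` is nilpotent, `p(A′)N′ ≠ N′`. Hence `p(A′)` annihilates `N′`, and this
  is equivalent to (a). To prove (b) we apply Lemma 3 to the transformation `A′|ker p(A′)`. Since `N′` is a minimal lattice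
  element for this transformation, we can conclude from (d) that `N′` has `K`-dimension `1`. Since `[K : F] = d`, `N′` has
  `F`-dimension `d`, and (b) follows. Finally, (c) follows from (b) by construction of a maximal chain in `L(A)` extending from
  `{0}` to `M`.»
* **Lemma 5** (p. 814): «Let `A` be `p`-primary, and let `M ∈ L(A)`. Then (a) `p(A)⁻¹M ∈ L(A)`, (b) the interval
  `[M, p(A)⁻¹M]` in `L(A)` is a simple sublattice, and (c) `M ⊂ rng p(A)` implies `dim p(A)⁻¹M − dim M = dim ker p(A)`.»
  Proof of (a): «`Ap(A)⁻¹M ⊂ p(A)⁻¹M` is equivalent to `p(A)Ap(A)⁻¹M ⊂ M` …».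
* §3 (p. 815): «1. `L(A)` is irreducible if and only if `A` is primary.» (Theorem 1, p. 812: «`L(A) = Σ_t ⊕ L(A_t)` and each
  direct summand `L(A_t)` is irreducible».)
* **Lemma 3** (p. 813): «Let `m_A` be irreducible, and let `K` be the algebra of polynomials in `A` with coefficients in `F`. Then
  (a) `K` is a field isomorphic to that obtained by adjoining a root of `m_A` to `F`, …»; Lemma 2 proof (p. 813): «if
  `{0} ≠ M ∈ L(A)`, then `A|M` has minimum polynomial `pᵏ` for some `k ≥ 1`. Hence `M ⊂ ker p(A)ᵏ`.»
* Theorem 9, proof (p. 821): «The minimum polynomial of `A₁|ker p₁(A₁)` is `p₁`, and so by Lemma 3 the interval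
  `[{0}, ker p₁(A₁)]` in `L(A₁)` is the lattice of all subspaces of a vector space over `K₁`. … Since this interval is
  complemented, so is its image `[{0}, N]` in `L(A₂)`. Theorem 5 now implies that `p₂` is the minimum polynomial of `A₂|N`».

## Contents (all proved; any field `k`, `V` finite-dimensional)
* §1 the `p`-primary bookkeeping: `m_A ∣ pⁿ` gives `χ_A = p^m` with `m·d = dim V` (`exists_charpoly_eq_pow_of_minpoly_dvd_pow`),
  hence **Lemma 4 (c)** `d ∣ dim M` for every `M ∈ L(A)` (through `A|M`; [BF67] derive (c) from (b) — here (c) comes first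
  and is USED for (b)).
* §2 **Lemma 5 (a)** and its companions for ANY `A` and polynomial `q`: `q(A)M`, `q(A)⁻¹M ∈ L(A)` for `M ∈ L(A)`; **Lemma 4 (a)**
  for any polynomial `q` with `q(A)` nilpotent: a cover `M ⋖ N` in `L(A)` has `q(A)N ⊆ M` (quotient-free, as in the nilpotent
  file: `M + q(A)N ∈ L(A)` lies between `M` and `N`, and `= N` would give `N ⊆ M + q(A)ⁱN` for all `i`).
* §3 **Lemma 4 (b)**: a cover `M ⋖ N` in `L(A)`, `A` `p`-primary, has `dim N = dim M + d` — quotient-free squeeze replacing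
  Lemma 3: `N = M + Z(x)` for any `x ∈ N ∖ M`, `p(A)x ∈ M` by (a), so `dim N ≤ dim M + dim Z(x) − dim Z(p(A)x) = dim M + d`
  (orders `pʲ`, `p^{j−1}`), while (c) and `dim M < dim N` give `dim N ≥ dim M + d`; the `CovBy` form on `↥L(A)`; atoms of
  `L(A)` have dimension `d`.
* §4 consequences of Lemma 4: every proper `M ∈ L(A)` is covered (`exists_gt_finrank_eq_add_natDegree`); through every
  `M ∈ L(A)` pass members of every dimension `dim M + jd ≤ dim V`; **the dimensions of the members of `L(A)` are exactly the
  multiples of `d` up to `dim V`** (`exists_mem_invtSubmodule_finrank_eq_iff`); maximal chains climb by `d`.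
* §5 **§3 item 1, «`L(A)` is irreducible if and only if `A` is primary»**: a non-primary `A` (`m_A = pʳ·c`, `p ∤ c`, `c`
  non-unit) splits `V = Ker p(A)ʳ ∔ Ker c(A)` into non-zero invariant subspaces along which EVERY invariant subspace splits
  (Lemma 1 ⟸, the tree's `eq_inf_sup_inf_of_isCoprime`); with Theorem 1's irreducibility clause (the tree's
  `exists_ne_inf_sup_inf_of_minpoly_eq_pow`) this is the equivalence `forall_isCompl_exists_ne_inf_sup_inf_iff_primary`.
  Lemma 5 (c) is the tree's `finrank_comap_eq_add` applied to `p(A)`; Lemma 5 (b) (simplicity) is not formalised.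
* §6 **the socle series is lattice-intrinsic** (`A` `p`-primary): an invariant `M` with `dim M ≤ j·d` lies in `Ker p(A)ʲ` («Hence
  `M ⊂ ker p(A)ᵏ`»), so `Ker p(A)ʲ` is the join of the members of dimension `≤ j·d` (`ker_aeval_pow_eq_sSup`, `isLeast_ker_aeval_pow`);
  **the argument of Theorem 9**: the interval `[0, M]` of `L(A)` is complemented iff `M ⊆ Ker p(A)`
  (`forall_exists_compl_le_iff_le_ker_aeval`, through Mathlib's `Module.End.isSemisimple_restrict_iff`), so `Ker p(A)` is the
  greatest member with complemented lower interval (`isGreatest_ker_aeval`).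
* §7 `A` `p`-primary is cyclic iff `dim Ker p(A) ≤ d` (Thm. 4 Cor. 2 of `InvariantSubspaceLatticeDistributive` with the single
  prime `p`).
* §8 **Lemma 3 (a)**: `k[A] ≅ k[x]/(m_A)` (the tree's pieces assembled), so `k[A]` is a field iff `m_A` is irreducible
  (`isField_adjoin_singleton_iff_irreducible_minpoly`). Lemma 3 (b)–(d) (the `K`-vector-space structure) are not formalised.

## References
* [BrickmanFillmore1967] L. Brickman, P. A. Fillmore, Canad. J. Math. 19 (1967) 810–822, doi:10.4153/cjm-1967-075-4 — p. 811
  (primary; irreducible lattice), Lemma 2 proof, Lemma 3 (a), Lemma 4 (p. 813), Lemma 5 (p. 814), Theorem 1 (p. 812), §3 item 1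
  (p. 815), Thm. 4 Cor. 2 (p. 816), Theorem 9 proof (p. 821).
* [GohbergLancasterRodman2006] I. Gohberg, P. Lancaster, L. Rodman, *Invariant Subspaces of Matrices with Applications*, SIAM
  Classics 51 — Thm. 2.5.1 (d) (held text p. 0075).
* [HoffmanKunze1971LinearAlgebra] K. Hoffman, R. Kunze, *Linear Algebra*, 2nd ed. — §6.8 (primary decomposition), §7.2
  (cyclic decomposition; `Z(x; A)` and the `A`-annihilator) — through the tree.
-/

open Module Polynomial UniqueFactorizationMonoid

namespace Literature.LinearAlgebra

variable {k : Type*} [Field k] {V : Type*} [AddCommGroup V] [Module k V]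

/-! ## §1 `p`-primary bookkeeping: `χ_A = p^m`; Lemma 4 (c) `d ∣ dim M` for every `M ∈ L(A)` -/

section Bookkeeping

variable [FiniteDimensional k V] (γ : Module.End k V)

/-- If `m_A ∣ pⁿ` (`p` monic irreducible) then `χ_A = p^m` with `m · deg p = dim V` (every prime factor of `χ_A` divides
`m_A`). [cite: BrickmanFillmore1967, Lemma 4 (c) (p. 813), p. 811 («primary»)] [cite: HoffmanKunze1971LinearAlgebra, §7.2 Theorem 4 (iii)] -/
theorem exists_charpoly_eq_pow_of_minpoly_dvd_pow {p : k[X]} (hp : Irreducible p) (hpm : p.Monic) {n : ℕ}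
    (hμ : minpoly k γ ∣ p ^ n) : ∃ m : ℕ, γ.charpoly = p ^ m ∧ m * p.natDegree = finrank k V := by
  classical
  have hχ : γ.charpoly.Monic := γ.charpoly_monic
  have hfac : ∀ Q ∈ normalizedFactors γ.charpoly, Q = p := fun Q hQ ↦
    eq_of_monic_of_associated (monic_of_mem_normalizedFactors hQ) hpm
      ((irreducible_of_normalized_factor Q hQ).associated_of_dvd hp
        ((prime_of_normalized_factor Q hQ).dvd_of_dvd_pow
          (((prime_dvd_charpoly_iff_dvd_minpoly γ (prime_of_normalized_factor Q hQ)).1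
            (dvd_of_mem_normalizedFactors hQ)).trans hμ)))
  have hχm : γ.charpoly = p ^ Multiset.card (normalizedFactors γ.charpoly) := by
    have hassoc := prod_normalizedFactors hχ.ne_zero
    rw [Multiset.eq_replicate_card.2 hfac, Multiset.prod_replicate] at hassoc
    exact (eq_of_monic_of_associated (hpm.pow _) hχ hassoc).symm
  refine ⟨_, hχm, ?_⟩
  have hdeg := congrArg natDegree hχm
  rw [LinearMap.charpoly_natDegree, natDegree_pow] at hdeg
  exact hdeg.symm

/-- **Lemma 4 (c): for `A` `p`-primary, `d = deg p` divides `dim M` for every `M ∈ L(A)`** («`d | dim M` for every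
`M ∈ L(A)`»; through the characteristic polynomial of `A|M`, a power of `p`). [cite: BrickmanFillmore1967, Lemma 4 (c) (p. 813)] -/
theorem natDegree_dvd_finrank_of_mem_invtSubmodule {p : k[X]} (hp : Irreducible p) (hpm : p.Monic) {n : ℕ}
    (hμ : minpoly k γ ∣ p ^ n) {M : Submodule k V} (hM : M ∈ γ.invtSubmodule) : p.natDegree ∣ finrank k M := by
  have hM' := (Module.End.mem_invtSubmodule_iff_forall_mem_of_mem γ).1 hM
  obtain ⟨m, -, hm⟩ := exists_charpoly_eq_pow_of_minpoly_dvd_pow (γ.restrict hM') hp hpm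
    ((minpoly_restrict_dvd γ hM').trans hμ)
  exact ⟨m, by rw [← hm, mul_comm]⟩

/-- In particular `d ∣ dim V` for a `p`-primary `A`. [cite: BrickmanFillmore1967, Lemma 4 (c) (p. 813)] -/
theorem natDegree_dvd_finrank_of_minpoly_dvd_pow {p : k[X]} (hp : Irreducible p) (hpm : p.Monic) {n : ℕ}
    (hμ : minpoly k γ ∣ p ^ n) : p.natDegree ∣ finrank k V := by
  rw [← finrank_top k V]
  exact natDegree_dvd_finrank_of_mem_invtSubmodule γ hp hpm hμ (Module.End.invtSubmodule.top_mem γ)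

end Bookkeeping

/-! ## §2 Lemma 5 (a): `q(A)M`, `q(A)⁻¹M ∈ L(A)`; Lemma 4 (a): a cover `M ⋖ N` has `q(A)N ⊆ M` whenever `q(A)` is nilpotent -/

section CoverA

variable (γ : Module.End k V)

/-- `q(A)` commutes with `A`. [folklore] -/
private theorem aeval_mul_self_comm (q : k[X]) : aeval γ q * γ = γ * aeval γ q := by
  simpa only [map_mul, aeval_X] using congrArg (aeval γ) (mul_comm q X)

/-- `q(A)M ∈ L(A)` for `M ∈ L(A)` («`p(A′)N′ ∈ L(A′)`»). [cite: BrickmanFillmore1967, Lemma 4 proof (p. 813)] -/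
theorem map_aeval_mem_invtSubmodule {M : Submodule k V} (hM : M ∈ γ.invtSubmodule) (q : k[X]) :
    M.map (aeval γ q) ∈ γ.invtSubmodule := by
  rw [Module.End.mem_invtSubmodule_iff_forall_mem_of_mem] at hM ⊢
  rintro _ ⟨x, hx, rfl⟩
  refine ⟨γ x, hM _ hx, ?_⟩
  rw [← Module.End.mul_apply, ← Module.End.mul_apply, aeval_mul_self_comm]

/-- **Lemma 5 (a): `q(A)⁻¹M ∈ L(A)` for `M ∈ L(A)`** («`Ap(A)⁻¹M ⊂ p(A)⁻¹M` is equivalent to `p(A)Ap(A)⁻¹M ⊂ M`»; any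
polynomial `q`, any `A`). [cite: BrickmanFillmore1967, Lemma 5 (a) (p. 814)] -/
theorem comap_aeval_mem_invtSubmodule {M : Submodule k V} (hM : M ∈ γ.invtSubmodule) (q : k[X]) :
    M.comap (aeval γ q) ∈ γ.invtSubmodule := by
  rw [Module.End.mem_invtSubmodule_iff_forall_mem_of_mem] at hM ⊢
  intro x hx
  rw [Submodule.mem_comap] at hx ⊢
  rw [← Module.End.mul_apply, aeval_mul_self_comm, Module.End.mul_apply]
  exact hM _ hx

/-- `M ⊆ q(A)⁻¹(q(A)M)` and `q(A)(q(A)⁻¹M) ⊆ M`: the interval `[M, q(A)⁻¹M]` of `L(A)` contains `M` («the interval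
`[M, p(A)⁻¹M]` in `L(A)`»). [cite: BrickmanFillmore1967, Lemma 5 (b) (p. 814)] -/
theorem le_comap_aeval_of_mem_invtSubmodule {M : Submodule k V} (hM : M ∈ γ.invtSubmodule) (q : k[X]) :
    M ≤ M.comap (aeval γ q) :=
  (Module.End.mem_invtSubmodule _).1 (invtSubmodule_le_invtSubmodule_aeval γ q hM)

/-- **Lemma 4 (a), for any polynomial `q` with `q(A)` nilpotent: if `N` covers `M` in `L(A)` then `q(A)N ⊆ M`** («`N′ = N/M` is
a minimal non-zero element of `L(A′)`. But `p(A′)N′ ⊂ N′` and `p(A′)N′ ∈ L(A′)`. Since `p(A′)` is nilpotent, `p(A′)N′ ≠ N′`.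
Hence `p(A′)` annihilates `N′`»; quotient-free: `M + q(A)N ∈ L(A)` lies between `M` and `N`, and `M + q(A)N = N` would give
`N ⊆ M + q(A)ⁱN` for every `i`). [cite: BrickmanFillmore1967, Lemma 4 (a) (p. 813)] -/
theorem map_aeval_le_of_covBy' {q : k[X]} (hq : IsNilpotent (aeval γ q)) {M N : Submodule k V}
    (hM : M ∈ γ.invtSubmodule) (hN : N ∈ γ.invtSubmodule) (hlt : M < N)
    (hcov : ∀ P ∈ γ.invtSubmodule, M ≤ P → P ≤ N → P = M ∨ P = N) : N.map (aeval γ q) ≤ M := by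
  have hqN : N.map (aeval γ q) ≤ N :=
    (Module.End.mem_invtSubmodule_iff_map_le _).1 (invtSubmodule_le_invtSubmodule_aeval γ q hN)
  rcases hcov (M ⊔ N.map (aeval γ q)) (Module.End.invtSubmodule.sup_mem hM (map_aeval_mem_invtSubmodule γ hN q))
      le_sup_left (sup_le hlt.le hqN) with h | h
  · exact le_sup_right.trans h.le
  · -- `N = M + q(A)N` gives `N ⊆ M + q(A)ⁱN` for every `i`, hence `N ⊆ M`
    exfalso
    obtain ⟨r, hr⟩ := hq
    have key : ∀ i : ℕ, N ≤ M ⊔ N.map (aeval γ q ^ i) := by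
      intro i
      induction i with
      | zero => rw [pow_zero, Module.End.one_eq_id, Submodule.map_id]; exact le_sup_right
      | succ i ih =>
        have h1 : N.map (aeval γ q ^ i) ≤ M ⊔ N.map (aeval γ q ^ (i + 1)) := by
          conv_lhs => rw [← h]
          rw [Submodule.map_sup, pow_succ, Module.End.mul_eq_comp, Submodule.map_comp]
          exact sup_le (((Module.End.mem_invtSubmodule_iff_map_le _).1
            (mem_invtSubmodule_pow _ (invtSubmodule_le_invtSubmodule_aeval γ q hM) i)).trans le_sup_left) le_sup_right
        exact ih.trans (sup_le le_sup_left h1)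
    have hNM : N ≤ M := by
      have h2 := key r
      rwa [hr, Submodule.map_zero, sup_bot_eq] at h2
    exact hlt.ne (le_antisymm hlt.le hNM)

/-- For `A` `p`-primary (`m_A ∣ pⁿ`), `p(A)` is nilpotent. [cite: BrickmanFillmore1967, Lemma 4 proof (p. 813: «Since `p(A′)` is nilpotent»)] -/
theorem isNilpotent_aeval_of_minpoly_dvd_pow {p : k[X]} {n : ℕ} (hμ : minpoly k γ ∣ p ^ n) : IsNilpotent (aeval γ p) :=
  ⟨n, by rw [← map_pow]; exact aeval_eq_zero_of_dvd_aeval_eq_zero hμ (minpoly.aeval k γ)⟩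

/-- **Lemma 4 (a): for `A` `p`-primary, a cover `M ⋖ N` in `L(A)` has `p(A)N ⊆ M`.** [cite: BrickmanFillmore1967, Lemma 4 (a) (p. 813)] -/
theorem map_aeval_le_of_covBy_of_minpoly_dvd_pow {p : k[X]} {n : ℕ} (hμ : minpoly k γ ∣ p ^ n) {M N : Submodule k V}
    (hM : M ∈ γ.invtSubmodule) (hN : N ∈ γ.invtSubmodule) (hlt : M < N)
    (hcov : ∀ P ∈ γ.invtSubmodule, M ≤ P → P ≤ N → P = M ∨ P = N) : N.map (aeval γ p) ≤ M :=
  map_aeval_le_of_covBy' γ (isNilpotent_aeval_of_minpoly_dvd_pow γ hμ) hM hN hlt hcov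

end CoverA

/-! ## §3 Lemma 4 (b): for `A` `p`-primary a cover `M ⋖ N` in `L(A)` has `dim N = dim M + d` -/

section CoverB

variable [FiniteDimensional k V] (γ : Module.End k V)

/-- The `A`-annihilator of a vector of a `p`-primary `A` is a power `pʲ`, `j ≥ 1` for `x ≠ 0`.
[cite: BrickmanFillmore1967, Lemma 2 proof (p. 813: «`A|M` has minimum polynomial `pᵏ`»)] -/
theorem exists_annihilatorPoly_eq_pow {p : k[X]} (hp : Irreducible p) (hpm : p.Monic) {n : ℕ}
    (hμ : minpoly k γ ∣ p ^ n) (x : V) : ∃ j ≤ n, annihilatorPoly γ x = p ^ j := by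
  have hq : annihilatorPoly γ x ∣ p ^ n := (annihilatorPoly_dvd_iff γ x).2 (by
    rw [aeval_eq_zero_of_dvd_aeval_eq_zero hμ (minpoly.aeval k γ), LinearMap.zero_apply])
  obtain ⟨j, hjn, hassoc⟩ := (dvd_prime_pow hp.prime n).1 hq
  exact ⟨j, hjn, eq_of_monic_of_associated (annihilatorPoly_monic γ x) (hpm.pow j) hassoc⟩

/-- If `x` has order `p^{j+1}` then `p(A)x` has order `pʲ`: `dim Z(x) = dim Z(p(A)x) + d`.
[cite: BrickmanFillmore1967, Lemma 4 (b) (p. 813)] [cite: HoffmanKunze1971LinearAlgebra, §7.2 (the `A`-annihilator of `g(A)α`)] -/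
theorem finrank_cyclicSubspace_eq_add_of_annihilatorPoly_eq_pow_succ {p : k[X]} (hpm : p.Monic) {x : V} {j : ℕ}
    (hx : annihilatorPoly γ x = p ^ (j + 1)) :
    finrank k ↥(cyclicSubspace γ x) = finrank k ↥(cyclicSubspace γ (aeval γ p x)) + p.natDegree := by
  classical
  have hord : annihilatorPoly γ (aeval γ p x) = p ^ j := by
    have h' := annihilatorPoly_aeval_apply_mul_gcd γ x p
    have hgcd : gcd (annihilatorPoly γ x) p = p :=
      (gcd_eq_right_iff _ _ hpm.normalize_eq_self).2 (hx ▸ dvd_pow_self p (Nat.succ_ne_zero j))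
    rw [hgcd, hx, pow_succ] at h'
    exact mul_right_cancel₀ hpm.ne_zero h'
  rw [← natDegree_annihilatorPoly_eq_finrank, ← natDegree_annihilatorPoly_eq_finrank, hx, hord, pow_succ,
    (hpm.pow j).natDegree_mul hpm]

/-- **Lemma 4 (b): for `A` `p`-primary (`m_A ∣ pⁿ`, `d = deg p`), if `N` covers `M` in `L(A)` then `dim N = dim M + d`.**
(Quotient-free: for `x ∈ N ∖ M`, `N = M + Z(x)` and `Z(p(A)x) ⊆ M ∩ Z(x)` by (a), so `dim N ≤ dim M + d`; by (c) and
`dim M < dim N`, `dim N ≥ dim M + d`.) The nilpotent case (`d = 1`) is `NilpotentInvariantSubspaceLattice.finrank_eq_add_one_of_covBy'`.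
[cite: BrickmanFillmore1967, Lemma 4 (b) (p. 813)] -/
theorem finrank_eq_add_natDegree_of_covBy' {p : k[X]} (hp : Irreducible p) (hpm : p.Monic) {n : ℕ}
    (hμ : minpoly k γ ∣ p ^ n) {M N : Submodule k V} (hM : M ∈ γ.invtSubmodule) (hN : N ∈ γ.invtSubmodule)
    (hlt : M < N) (hcov : ∀ P ∈ γ.invtSubmodule, M ≤ P → P ≤ N → P = M ∨ P = N) :
    finrank k N = finrank k M + p.natDegree := by
  have hpN : N.map (aeval γ p) ≤ M := map_aeval_le_of_covBy_of_minpoly_dvd_pow γ hμ hM hN hlt hcov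
  obtain ⟨x, hxN, hxM⟩ := SetLike.exists_of_lt hlt
  have hx0 : x ≠ 0 := fun h ↦ hxM (h ▸ M.zero_mem)
  -- `N = M + Z(x)`
  have hMZ : M ⊔ cyclicSubspace γ x = N := by
    rcases hcov _ (Module.End.invtSubmodule.sup_mem hM (cyclicSubspace_mem_invtSubmodule γ x)) le_sup_left
        (sup_le hlt.le ((cyclicSubspace_le_iff γ x hN).2 hxN)) with h | h
    · exact absurd (h.le (Submodule.mem_sup_right (self_mem_cyclicSubspace γ x))) hxM
    · exact h
  -- the order of `x` is `p^(j+1)`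
  obtain ⟨j', -, hj'⟩ := exists_annihilatorPoly_eq_pow γ hp hpm hμ x
  obtain ⟨j, rfl⟩ : ∃ j, j' = j + 1 := Nat.exists_eq_succ_of_ne_zero (by
    rintro rfl
    rw [pow_zero] at hj'
    exact hx0 ((annihilatorPoly_eq_one_iff γ x).1 hj'))
  have hdim := finrank_cyclicSubspace_eq_add_of_annihilatorPoly_eq_pow_succ γ hpm hj'
  -- `Z(p(A)x) ⊆ M ∩ Z(x)`
  have hle' : cyclicSubspace γ (aeval γ p x) ≤ M ⊓ cyclicSubspace γ x :=
    le_inf ((cyclicSubspace_le_iff γ _ hM).2 (hpN ⟨x, hxN, rfl⟩))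
      ((cyclicSubspace_le_iff γ _ (cyclicSubspace_mem_invtSubmodule γ x)).2 (aeval_apply_self_mem_cyclicSubspace γ x p))
  have hinf := Submodule.finrank_mono hle'
  have hsum := Submodule.finrank_sup_add_finrank_inf_eq M (cyclicSubspace γ x)
  rw [hMZ] at hsum
  -- lower bound from (c)
  have hdvd : p.natDegree ∣ finrank k N - finrank k M :=
    Nat.dvd_sub (natDegree_dvd_finrank_of_mem_invtSubmodule γ hp hpm hμ hN)
      (natDegree_dvd_finrank_of_mem_invtSubmodule γ hp hpm hμ hM)
  have hltd : finrank k M < finrank k N := Submodule.finrank_lt_finrank_of_lt hlt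
  have hlow := Nat.le_of_dvd (Nat.sub_pos_of_lt hltd) hdvd
  omega

/-- **Lemma 4 in the lattice `↥L(A)` itself** (Mathlib's `⋖`): for `A` `p`-primary, `M ⋖ N` in `L(A)` gives `p(A)N ⊆ M` and
`dim N = dim M + d`. [cite: BrickmanFillmore1967, Lemma 4 (a), (b) (p. 813)] -/
theorem map_aeval_le_and_finrank_eq_of_covBy {p : k[X]} (hp : Irreducible p) (hpm : p.Monic) {n : ℕ}
    (hμ : minpoly k γ ∣ p ^ n) {M N : γ.invtSubmodule} (h : M ⋖ N) :
    (N : Submodule k V).map (aeval γ p) ≤ M ∧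
      finrank k (N : Submodule k V) = finrank k (M : Submodule k V) + p.natDegree := by
  have hlt : (M : Submodule k V) < N := h.lt
  have hcov : ∀ P ∈ γ.invtSubmodule, (M : Submodule k V) ≤ P → P ≤ N → P = M ∨ P = N := by
    intro P hP hMP hPN
    rcases hMP.eq_or_lt with h1 | h1
    · exact Or.inl h1.symm
    rcases hPN.eq_or_lt with h2 | h2
    · exact Or.inr h2
    exact absurd (show (⟨P, hP⟩ : γ.invtSubmodule) < N from h2) (h.2 (show M < ⟨P, hP⟩ from h1))
  exact ⟨map_aeval_le_of_covBy_of_minpoly_dvd_pow γ hμ M.2 N.2 hlt hcov,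
    finrank_eq_add_natDegree_of_covBy' γ hp hpm hμ M.2 N.2 hlt hcov⟩

/-- **The atoms of `L(A)` (`A` `p`-primary) have dimension `d`**: a minimal non-zero invariant subspace covers `{0}`
(«`N′` has `K`-dimension `1` … `F`-dimension `d`»). [cite: BrickmanFillmore1967, Lemma 4 (b) (p. 813), Lemma 3 (b), (d) (p. 813)] -/
theorem finrank_eq_natDegree_of_minimal {p : k[X]} (hp : Irreducible p) (hpm : p.Monic) {n : ℕ}
    (hμ : minpoly k γ ∣ p ^ n) {W : Submodule k V} (hW : W ∈ γ.invtSubmodule) (hW0 : W ≠ ⊥)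
    (hmin : ∀ U ∈ γ.invtSubmodule, U ≤ W → U = ⊥ ∨ U = W) : finrank k W = p.natDegree := by
  have h := finrank_eq_add_natDegree_of_covBy' γ hp hpm hμ (Module.End.invtSubmodule.bot_mem γ) hW
    (bot_lt_iff_ne_bot.2 hW0) fun P hP _ hPW ↦ hmin P hP hPW
  rwa [finrank_bot, zero_add] at h

end CoverB

/-! ## §4 Consequences of Lemma 4: covers exist, flags by steps of `d`, and the dimensions of the members of `L(A)` are
exactly the multiples of `d` -/

section Flags

variable [FiniteDimensional k V] (γ : Module.End k V)

omit [FiniteDimensional k V] in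
/-- Above a proper member `M` of `L(A)` there is a cover: an invariant `N > M` with no invariant subspace strictly between
(take `N > M` invariant of least dimension). [cite: BrickmanFillmore1967, Lemma 4 (c) proof (p. 813: «a maximal chain in `L(A)`»)] -/
theorem exists_covBy'_of_ne_top [FiniteDimensional k V] {M : Submodule k V} (hMt : M ≠ ⊤) :
    ∃ N ∈ γ.invtSubmodule, M < N ∧ ∀ P ∈ γ.invtSubmodule, M ≤ P → P ≤ N → P = M ∨ P = N := by
  classical
  have hex : ∃ r : ℕ, ∃ N ∈ γ.invtSubmodule, M < N ∧ finrank k N = r :=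
    ⟨_, ⊤, Module.End.invtSubmodule.top_mem γ, lt_top_iff_ne_top.2 hMt, rfl⟩
  obtain ⟨N, hN, hMN, hNr⟩ := Nat.find_spec hex
  refine ⟨N, hN, hMN, fun P hP hMP hPN ↦ ?_⟩
  rcases hMP.eq_or_lt with h | h
  · exact Or.inl h.symm
  · refine Or.inr (Submodule.eq_of_le_of_finrank_le hPN ?_)
    rw [hNr]
    exact Nat.find_min' hex ⟨P, hP, h, rfl⟩

/-- **Every proper `M ∈ L(A)` (`A` `p`-primary) lies under an invariant `N` with `dim N = dim M + d`.**
[cite: BrickmanFillmore1967, Lemma 4 (b), (c) (p. 813)] -/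
theorem exists_gt_finrank_eq_add_natDegree {p : k[X]} (hp : Irreducible p) (hpm : p.Monic) {n : ℕ}
    (hμ : minpoly k γ ∣ p ^ n) {M : Submodule k V} (hM : M ∈ γ.invtSubmodule) (hMt : M ≠ ⊤) :
    ∃ N ∈ γ.invtSubmodule, M < N ∧ finrank k N = finrank k M + p.natDegree := by
  obtain ⟨N, hN, hMN, hcov⟩ := exists_covBy'_of_ne_top γ hMt
  exact ⟨N, hN, hMN, finrank_eq_add_natDegree_of_covBy' γ hp hpm hμ hM hN hMN hcov⟩

/-- **Flags by steps of `d`: through every `M ∈ L(A)` pass invariant subspaces of every dimension `dim M + jd ≤ dim V`**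
(«construction of a maximal chain in `L(A)` extending from `{0}` to `M`»). [cite: BrickmanFillmore1967, Lemma 4 (c) (p. 813)] -/
theorem exists_ge_finrank_eq_add_mul_natDegree {p : k[X]} (hp : Irreducible p) (hpm : p.Monic) {n : ℕ}
    (hμ : minpoly k γ ∣ p ^ n) {M : Submodule k V} (hM : M ∈ γ.invtSubmodule) {j : ℕ}
    (hj : finrank k M + j * p.natDegree ≤ finrank k V) :
    ∃ N ∈ γ.invtSubmodule, M ≤ N ∧ finrank k N = finrank k M + j * p.natDegree := by
  induction j with
  | zero => exact ⟨M, hM, le_rfl, by rw [zero_mul, add_zero]⟩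
  | succ j ih =>
    have hd := hp.natDegree_pos
    obtain ⟨N, hN, hMN, hNj⟩ := ih (by rw [Nat.succ_mul] at hj; omega)
    have hNt : N ≠ ⊤ := by
      rintro rfl
      rw [finrank_top] at hNj
      rw [Nat.succ_mul] at hj
      omega
    obtain ⟨N', hN', hNN', hN'j⟩ := exists_gt_finrank_eq_add_natDegree γ hp hpm hμ hN hNt
    exact ⟨N', hN', hMN.trans hNN'.le, by rw [hN'j, hNj, Nat.succ_mul, add_assoc]⟩

/-- **The dimensions of the members of `L(A)` (`A` `p`-primary) are exactly the multiples of `d` not exceeding `dim V`.**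
[cite: BrickmanFillmore1967, Lemma 4 (c) (p. 813)] -/
theorem exists_mem_invtSubmodule_finrank_eq_iff {p : k[X]} (hp : Irreducible p) (hpm : p.Monic) {n : ℕ}
    (hμ : minpoly k γ ∣ p ^ n) {r : ℕ} :
    (∃ N ∈ γ.invtSubmodule, finrank k N = r) ↔ p.natDegree ∣ r ∧ r ≤ finrank k V := by
  constructor
  · rintro ⟨N, hN, rfl⟩
    exact ⟨natDegree_dvd_finrank_of_mem_invtSubmodule γ hp hpm hμ hN, Submodule.finrank_le N⟩
  · rintro ⟨⟨j, rfl⟩, hr⟩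
    obtain ⟨N, hN, -, hNj⟩ := exists_ge_finrank_eq_add_mul_natDegree γ hp hpm hμ (M := ⊥)
      (Module.End.invtSubmodule.bot_mem γ) (j := j) (by rw [finrank_bot, zero_add, mul_comm]; exact hr)
    exact ⟨N, hN, by rw [hNj, finrank_bot, zero_add, mul_comm]⟩

/-- **Maximal chains of `L(A)` climb by `d`**: a strictly increasing pair `M < N` in `L(A)` has `dim N ≥ dim M + d`, so every
chain in `L(A)` has at most `dim V / d + 1` members between `{0}` and `V`. [cite: BrickmanFillmore1967, Lemma 4 (c) (p. 813)] -/
theorem finrank_add_natDegree_le_of_lt {p : k[X]} (hp : Irreducible p) (hpm : p.Monic) {n : ℕ}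
    (hμ : minpoly k γ ∣ p ^ n) {M N : Submodule k V} (hM : M ∈ γ.invtSubmodule) (hN : N ∈ γ.invtSubmodule)
    (hlt : M < N) : finrank k M + p.natDegree ≤ finrank k N := by
  have hdvd : p.natDegree ∣ finrank k N - finrank k M :=
    Nat.dvd_sub (natDegree_dvd_finrank_of_mem_invtSubmodule γ hp hpm hμ hN)
      (natDegree_dvd_finrank_of_mem_invtSubmodule γ hp hpm hμ hM)
  have hltd : finrank k M < finrank k N := Submodule.finrank_lt_finrank_of_lt hlt
  have hlow := Nat.le_of_dvd (Nat.sub_pos_of_lt hltd) hdvd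
  omega

end Flags

/-! ## §5 §3 item 1: `L(A)` is irreducible iff `A` is primary -/

section Irreducible

variable [FiniteDimensional k V] (γ : Module.End k V)

/-- **A non-primary `A` splits its lattice**: if `m_A` is not a prime power then `m_A = pʳ · c` with `p ∤ c`, `c` a non-unit,
`V = Ker p(A)ʳ ∔ Ker c(A)` with both summands non-zero invariant, and EVERY invariant subspace `N` is
`(N ∩ Ker p(A)ʳ) + (N ∩ Ker c(A))` (Lemma 1 ⟸) — `L(A) = L(A|V₁) ⊕ L(A|V₂)` non-trivially. [cite: BrickmanFillmore1967, Thm. 1 (p. 812), §3 item 1 (p. 815)] -/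
theorem exists_isCompl_forall_eq_inf_sup_inf_of_not_primary
    (h : ¬∃ p : k[X], Irreducible p ∧ p.Monic ∧ ∃ n : ℕ, minpoly k γ = p ^ n) :
    ∃ V₁ ∈ γ.invtSubmodule, ∃ V₂ ∈ γ.invtSubmodule, IsCompl V₁ V₂ ∧ V₁ ≠ ⊥ ∧ V₂ ≠ ⊥ ∧
      ∀ N ∈ γ.invtSubmodule, N = (N ⊓ V₁) ⊔ (N ⊓ V₂) := by
  classical
  have hμ : (minpoly k γ).Monic := minpoly.monic (Algebra.IsIntegral.isIntegral γ)
  have hμ1 : minpoly k γ ≠ 1 := fun h1 ↦ h ⟨X, irreducible_X, monic_X, 0, by rw [h1, pow_zero]⟩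
  -- a monic irreducible factor `p` of `m_A`, and `m_A = p ^ r * c` with `p ∤ c`
  obtain ⟨p₀, hp₀, hp₀μ⟩ := WfDvdMonoid.exists_irreducible_factor (mt hμ.isUnit_iff.1 hμ1) hμ.ne_zero
  have hp : Irreducible (normalize p₀) := (associated_normalize p₀).irreducible hp₀
  have hpm : (normalize p₀).Monic := monic_normalize hp₀.ne_zero
  have hpμ : normalize p₀ ∣ minpoly k γ := normalize_dvd_iff.2 hp₀μ
  obtain ⟨r, c, hndvd, hμeq⟩ := WfDvdMonoid.max_power_factor hμ.ne_zero hp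
  set p := normalize p₀ with hpdef
  have hr0 : r ≠ 0 := by
    rintro rfl
    rw [pow_zero, one_mul] at hμeq
    exact hndvd (hμeq ▸ hpμ)
  have hcm : c.Monic := (hpm.pow r).of_mul_monic_left (hμeq ▸ hμ)
  have hcu : ¬IsUnit c := fun hu ↦ h ⟨p, hp, hpm, r, by rw [hμeq, hcm.isUnit_iff.1 hu, mul_one]⟩
  have hcop : IsCoprime (p ^ r) c := (hp.coprime_iff_not_dvd.2 hndvd).pow_left
  have htop : LinearMap.ker (aeval γ (p ^ r)) ⊔ LinearMap.ker (aeval γ c) = ⊤ := by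
    rw [sup_ker_aeval_eq_ker_aeval_mul_of_coprime γ hcop, ← hμeq, minpoly.aeval, LinearMap.ker_zero]
  refine ⟨LinearMap.ker (aeval γ (p ^ r)), ker_aeval_mem_invtSubmodule γ _, LinearMap.ker (aeval γ c),
    ker_aeval_mem_invtSubmodule γ _, ⟨disjoint_ker_aeval_of_isCoprime γ hcop, codisjoint_iff.2 htop⟩, ?_, ?_, ?_⟩
  · exact ker_aeval_ne_bot_of_dvd_minpoly γ ⟨c, hμeq⟩ fun hu ↦ hp.not_isUnit ((isUnit_pow_iff hr0).1 hu)
  · exact ker_aeval_ne_bot_of_dvd_minpoly γ ⟨p ^ r, by rw [hμeq, mul_comm]⟩ hcu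
  · intro N hN
    exact eq_inf_sup_inf_of_isCoprime γ (fun v hv ↦ LinearMap.mem_ker.1 hv) (fun v hv ↦ LinearMap.mem_ker.1 hv) hcop hN
      (htop ▸ le_top)

/-- **§3 item 1: «`L(A)` is irreducible if and only if `A` is primary»** — no decomposition `V = V₁ ∔ V₂` into non-zero invariant
subspaces splits every invariant subspace iff `m_A` is a prime power (⟸: Theorem 1, the tree's
`exists_ne_inf_sup_inf_of_minpoly_eq_pow`; ⟹: the splitting above). [cite: BrickmanFillmore1967, §3 item 1 (p. 815), Thm. 1 (p. 812)] -/
theorem forall_isCompl_exists_ne_inf_sup_inf_iff_primary :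
    (∀ V₁ ∈ γ.invtSubmodule, ∀ V₂ ∈ γ.invtSubmodule, IsCompl V₁ V₂ → V₁ ≠ ⊥ → V₂ ≠ ⊥ →
        ∃ N ∈ γ.invtSubmodule, N ≠ (N ⊓ V₁) ⊔ (N ⊓ V₂)) ↔
      ∃ p : k[X], Irreducible p ∧ p.Monic ∧ ∃ n : ℕ, minpoly k γ = p ^ n := by
  refine ⟨fun hirr ↦ ?_, fun ⟨p, hp, _, n, hμ⟩ V₁ hV₁ V₂ hV₂ hc h₁0 h₂0 ↦
    exists_ne_inf_sup_inf_of_minpoly_eq_pow γ hp hμ hV₁ hV₂ hc h₁0 h₂0⟩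
  by_contra h
  obtain ⟨V₁, hV₁, V₂, hV₂, hc, h₁0, h₂0, hsplit⟩ := exists_isCompl_forall_eq_inf_sup_inf_of_not_primary γ h
  obtain ⟨N, hN, hne⟩ := hirr V₁ hV₁ V₂ hV₂ hc h₁0 h₂0
  exact hne (hsplit N hN)

end Irreducible

/-! ## §6 The socle `Ker p(A)` and the socle series `Ker p(A)ʲ` are lattice-intrinsic: `Ker p(A)` is the greatest member of
`L(A)` with complemented lower interval (the argument of [BF67] Thm. 9), `Ker p(A)ʲ` the join of the members of dimension `≤ jd` -/

section Socle

variable [FiniteDimensional k V] (γ : Module.End k V)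

/-- For `A` `p`-primary, the minimal polynomial of `A|M` (`M ∈ L(A)`) is `pˢ` with `s·d ≤ dim M` («`A|M` has minimum polynomial
`pᵏ` for some `k`»). [cite: BrickmanFillmore1967, Lemma 2 proof (p. 813)] -/
theorem exists_minpoly_restrict_eq_pow {p : k[X]} (hp : Irreducible p) (hpm : p.Monic) {n : ℕ} (hμ : minpoly k γ ∣ p ^ n)
    {M : Submodule k V} (hM : ∀ x ∈ M, γ x ∈ M) :
    ∃ s ≤ n, minpoly k (γ.restrict hM) = p ^ s ∧ s * p.natDegree ≤ finrank k M := by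
  obtain ⟨s, hs, hassoc⟩ := (dvd_prime_pow hp.prime n).1 ((minpoly_restrict_dvd γ hM).trans hμ)
  have heq : minpoly k (γ.restrict hM) = p ^ s :=
    eq_of_monic_of_associated (minpoly.monic (Algebra.IsIntegral.isIntegral _)) (hpm.pow s) hassoc
  refine ⟨s, hs, heq, ?_⟩
  have h := natDegree_minpoly_le_finrank (γ.restrict hM)
  rwa [heq, natDegree_pow] at h

/-- **«Hence `M ⊂ ker p(A)ᵏ`»: for `A` `p`-primary, an invariant `M` with `dim M ≤ j·d` lies in `Ker p(A)ʲ`** (the exponent of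
`A|M` is at most `dim M / d`). [cite: BrickmanFillmore1967, Lemma 2 proof (p. 813), Lemma 4 (c) (p. 813)] -/
theorem le_ker_aeval_pow_of_finrank_le {p : k[X]} (hp : Irreducible p) (hpm : p.Monic) {n : ℕ} (hμ : minpoly k γ ∣ p ^ n)
    {M : Submodule k V} (hM : M ∈ γ.invtSubmodule) {j : ℕ} (hj : finrank k M ≤ j * p.natDegree) :
    M ≤ LinearMap.ker (aeval γ (p ^ j)) := by
  have hM' := (Module.End.mem_invtSubmodule_iff_forall_mem_of_mem γ).1 hM
  obtain ⟨s, -, hs, hsd⟩ := exists_minpoly_restrict_eq_pow γ hp hpm hμ hM'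
  have hsj : s ≤ j := Nat.le_of_mul_le_mul_right (hsd.trans hj) hp.natDegree_pos
  intro x hx
  rw [LinearMap.mem_ker]
  have h0 : aeval (γ.restrict hM') (p ^ j) = 0 :=
    aeval_eq_zero_of_dvd_aeval_eq_zero (hs ▸ pow_dvd_pow p hsj) (minpoly.aeval k _)
  have := congrArg (fun f ↦ ((f ⟨x, hx⟩ : M) : V)) h0
  simpa only [aeval_restrict_apply, LinearMap.zero_apply, ZeroMemClass.coe_zero] using this

/-- Conversely every cyclic subspace `Z(x)`, `x ∈ Ker p(A)ʲ`, is a member of dimension `≤ j·d` (its order divides `pʲ`).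
[cite: BrickmanFillmore1967, Lemma 2 proof (p. 813), Lemma 3 (b) (p. 813)] -/
theorem finrank_cyclicSubspace_le_of_mem_ker_aeval_pow {p : k[X]} (hpm : p.Monic) {j : ℕ} {x : V}
    (hx : x ∈ LinearMap.ker (aeval γ (p ^ j))) : finrank k ↥(cyclicSubspace γ x) ≤ j * p.natDegree := by
  rw [← natDegree_annihilatorPoly_eq_finrank, ← natDegree_pow]
  exact natDegree_le_of_dvd ((annihilatorPoly_dvd_iff γ x).2 (LinearMap.mem_ker.1 hx)) (hpm.pow j).ne_zero

/-- **The socle series is lattice-intrinsic: for `A` `p`-primary, `Ker p(A)ʲ` is the join of the members of `L(A)` of dimension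
`≤ j·d`.** [cite: BrickmanFillmore1967, Lemma 2 proof (p. 813), Thm. 9 proof (p. 821: «the interval `[{0}, ker p₁(A₁)]` in `L(A₁)`»)] -/
theorem ker_aeval_pow_eq_sSup {p : k[X]} (hp : Irreducible p) (hpm : p.Monic) {n : ℕ} (hμ : minpoly k γ ∣ p ^ n) (j : ℕ) :
    LinearMap.ker (aeval γ (p ^ j)) = sSup {M : Submodule k V | M ∈ γ.invtSubmodule ∧ finrank k M ≤ j * p.natDegree} := by
  apply le_antisymm
  · intro x hx
    have hZ : cyclicSubspace γ x ∈ {M : Submodule k V | M ∈ γ.invtSubmodule ∧ finrank k M ≤ j * p.natDegree} :=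
      ⟨cyclicSubspace_mem_invtSubmodule γ x, finrank_cyclicSubspace_le_of_mem_ker_aeval_pow γ hpm hx⟩
    exact le_sSup hZ (self_mem_cyclicSubspace γ x)
  · exact sSup_le fun M hM ↦ le_ker_aeval_pow_of_finrank_le γ hp hpm hμ hM.1 hM.2

/-- … equivalently, `Ker p(A)ʲ` is the LEAST member of `L(A)` containing every member of dimension `≤ j·d`.
[cite: BrickmanFillmore1967, Lemma 2 proof (p. 813), Thm. 9 proof (p. 821)] -/
theorem isLeast_ker_aeval_pow {p : k[X]} (hp : Irreducible p) (hpm : p.Monic) {n : ℕ} (hμ : minpoly k γ ∣ p ^ n) (j : ℕ) :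
    IsLeast {N : Submodule k V | N ∈ γ.invtSubmodule ∧
        ∀ M ∈ γ.invtSubmodule, finrank k M ≤ j * p.natDegree → M ≤ N} (LinearMap.ker (aeval γ (p ^ j))) := by
  refine ⟨⟨ker_aeval_mem_invtSubmodule γ _, fun M hM hMj ↦ le_ker_aeval_pow_of_finrank_le γ hp hpm hμ hM hMj⟩,
    fun N hN ↦ ?_⟩
  rw [ker_aeval_pow_eq_sSup γ hp hpm hμ j]
  exact sSup_le fun M hM ↦ hN.2 M hM.1 hM.2

/-- **The socle `Ker p(A)` is lattice-intrinsic (the argument of [BF67] Theorem 9): for `A` `p`-primary and `M ∈ L(A)`, the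
interval `[0, M]` of `L(A)` is complemented iff `M ⊆ Ker p(A)`** («The minimum polynomial of `A₁|ker p₁(A₁)` is `p₁`, and so by
Lemma 3 the interval `[{0}, ker p₁(A₁)]` in `L(A₁)` is the lattice of all subspaces of a vector space over `K₁` … Since this
interval is complemented, so is its image `[{0}, N]` in `L(A₂)`. Theorem 5 now implies that `p₂` is the minimum polynomial of
`A₂|N`»; through Mathlib's `Module.End.isSemisimple_restrict_iff`). [cite: BrickmanFillmore1967, Thm. 9 proof (p. 821), Thm. 5 (p. 816)] -/
theorem forall_exists_compl_le_iff_le_ker_aeval {p : k[X]} (hp : Irreducible p) (hpm : p.Monic) {n : ℕ}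
    (hμ : minpoly k γ ∣ p ^ n) {M : Submodule k V} (hM : M ∈ γ.invtSubmodule) :
    (∀ N ∈ γ.invtSubmodule, N ≤ M → ∃ N' ≤ M, N' ∈ γ.invtSubmodule ∧ Disjoint N N' ∧ N ⊔ N' = M) ↔
      M ≤ LinearMap.ker (aeval γ p) := by
  rw [← Module.End.isSemisimple_restrict_iff M hM]
  have hM' := (Module.End.mem_invtSubmodule_iff_forall_mem_of_mem γ).1 hM
  constructor
  · intro hs
    -- the minimal polynomial of `A|M` is a squarefree power of `p`, i.e. `1` or `p`
    obtain ⟨s, -, hseq, -⟩ := exists_minpoly_restrict_eq_pow γ hp hpm hμ hM'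
    have hsq : Squarefree (minpoly k (γ.restrict hM')) := hs.minpoly_squarefree
    rw [hseq] at hsq
    have hs1 : s ≤ 1 := by
      by_contra hlt
      have h2 : p * p ∣ p ^ s := ⟨p ^ (s - 2), by rw [← pow_two, ← pow_add]; congr 1; omega⟩
      exact hp.not_isUnit (hsq p h2)
    intro x hx
    rw [LinearMap.mem_ker]
    have h0 : aeval (γ.restrict hM') p = 0 :=
      aeval_eq_zero_of_dvd_aeval_eq_zero (hseq ▸ (pow_dvd_pow p hs1).trans (pow_one p).dvd) (minpoly.aeval k _)
    have := congrArg (fun f ↦ ((f ⟨x, hx⟩ : M) : V)) h0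
    simpa only [aeval_restrict_apply, LinearMap.zero_apply, ZeroMemClass.coe_zero] using this
  · intro hle
    refine Module.End.isSemisimple_of_squarefree_aeval_eq_zero hp.squarefree (LinearMap.ext fun x ↦ Subtype.ext ?_)
    rw [aeval_restrict_apply γ hM' p x, LinearMap.zero_apply, ZeroMemClass.coe_zero]
    exact LinearMap.mem_ker.1 (hle x.2)

/-- Hence `Ker p(A)` is the GREATEST member of `L(A)` whose lower interval is complemented (`A` `p`-primary).
[cite: BrickmanFillmore1967, Thm. 9 proof (p. 821)] -/
theorem isGreatest_ker_aeval {p : k[X]} (hp : Irreducible p) (hpm : p.Monic) {n : ℕ} (hμ : minpoly k γ ∣ p ^ n) :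
    IsGreatest {M : Submodule k V | M ∈ γ.invtSubmodule ∧
        ∀ N ∈ γ.invtSubmodule, N ≤ M → ∃ N' ≤ M, N' ∈ γ.invtSubmodule ∧ Disjoint N N' ∧ N ⊔ N' = M}
      (LinearMap.ker (aeval γ p)) :=
  ⟨⟨ker_aeval_mem_invtSubmodule γ p,
      (forall_exists_compl_le_iff_le_ker_aeval γ hp hpm hμ (ker_aeval_mem_invtSubmodule γ p)).2 le_rfl⟩,
    fun _ hM ↦ (forall_exists_compl_le_iff_le_ker_aeval γ hp hpm hμ hM.1).1 hM.2⟩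

end Socle

/-! ## §7 Cyclic primary transformations: `A` `p`-primary is cyclic iff `dim Ker p(A) ≤ d` -/

section CyclicPrimary

variable [FiniteDimensional k V] (γ : Module.End k V)

/-- **For `A` `p`-primary: `A` is cyclic iff `dim Ker p(A) ≤ d`** (Brickman–Fillmore Thm. 4 Cor. 2 in general —
`cyclic_iff_forall_finrank_ker_aeval_le_natDegree` — with the only prime `p`; GLR Thm. 2.5.1 (d) «a unique eigenvector» for
`p = x − λ₀`). [cite: BrickmanFillmore1967, Thm. 4 Corollary 2 (p. 816), Lemma 3 (b) (p. 813)] [cite: GohbergLancasterRodman2006, Thm. 2.5.1 (d) (p. 0075)] -/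
theorem cyclic_iff_finrank_ker_aeval_le_natDegree_of_minpoly_dvd_pow {p : k[X]} (hp : Irreducible p) (hpm : p.Monic)
    {n : ℕ} (hμ : minpoly k γ ∣ p ^ n) :
    (∃ v : V, cyclicSubspace γ v = ⊤) ↔ finrank k ↥(LinearMap.ker (aeval γ p)) ≤ p.natDegree := by
  rw [cyclic_iff_forall_finrank_ker_aeval_le_natDegree]
  refine ⟨fun h ↦ ?_, fun h P hP hPm hPd ↦ ?_⟩
  · -- `p ∣ m_A` unless `V = 0`, where the bound is trivial
    by_cases hV : minpoly k γ = 1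
    · have h0 : LinearMap.ker (aeval γ p) = ⊥ := by
        haveI : Subsingleton V := by
          have h1 := minpoly.aeval k γ
          rw [hV, map_one] at h1
          exact ⟨fun a b ↦ by rw [← Module.End.one_apply (R := k) a, ← Module.End.one_apply (R := k) b, h1,
            LinearMap.zero_apply, LinearMap.zero_apply]⟩
        exact Subsingleton.elim _ _
      rw [h0, finrank_bot]
      exact Nat.zero_le _
    · obtain ⟨s, -, hassoc⟩ := (dvd_prime_pow hp.prime n).1 hμ
      have hs : minpoly k γ = p ^ s :=
        eq_of_monic_of_associated (minpoly.monic (Algebra.IsIntegral.isIntegral γ)) (hpm.pow s) hassoc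
      have hs0 : s ≠ 0 := by rintro rfl; rw [pow_zero] at hs; exact hV hs
      exact h p hp hpm (hs ▸ dvd_pow_self p hs0)
  · -- the only monic prime dividing `m_A ∣ pⁿ` is `p`
    have hPp : P = p := eq_of_monic_of_associated hPm hpm
      (hP.associated_of_dvd hp (hP.prime.dvd_of_dvd_pow (hPd.trans hμ)))
    rw [hPp]
    exact h

end CyclicPrimary

/-! ## §8 Lemma 3 (a): `F[A]` is a field iff `m_A` is irreducible -/

section FieldOfPolynomials

variable [FiniteDimensional k V] (γ : Module.End k V)

omit [FiniteDimensional k V] in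
/-- `k[A] ≅ k[x]/(m_A)` (the tree's `Algebra.adjoin_singleton_eq_range_aeval`, `Ideal.quotientKerEquivRange`,
`minpoly.ker_aeval_eq_span_minpoly`). [cite: BrickmanFillmore1967, Lemma 3 (a) (p. 813)] -/
theorem nonempty_adjoin_singleton_algEquiv_adjoinRoot_minpoly :
    Nonempty (Algebra.adjoin k ({γ} : Set (Module.End k V)) ≃ₐ[k] AdjoinRoot (minpoly k γ)) :=
  ⟨(Subalgebra.equivOfEq _ _ (Algebra.adjoin_singleton_eq_range_aeval k γ)).trans
    ((Ideal.quotientKerEquivRange (Polynomial.aeval (R := k) γ)).symm.trans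
      (Ideal.quotientEquivAlgOfEq k (minpoly.ker_aeval_eq_span_minpoly k γ)))⟩

omit [FiniteDimensional k V] in
/-- **Brickman–Fillmore LEMMA 3 (a): «Let `m_A` be irreducible, and let `K` be the algebra of polynomials in `A` with coefficients
in `F`. Then (a) `K` is a field isomorphic to that obtained by adjoining a root of `m_A` to `F`».** [cite: BrickmanFillmore1967, Lemma 3 (a) (p. 813)] -/
theorem isField_adjoin_singleton_of_irreducible_minpoly (h : Irreducible (minpoly k γ)) :
    IsField (Algebra.adjoin k ({γ} : Set (Module.End k V))) := by
  obtain ⟨e⟩ := nonempty_adjoin_singleton_algEquiv_adjoinRoot_minpoly γ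
  haveI := Fact.mk h
  exact MulEquiv.isField (Field.toIsField (AdjoinRoot (minpoly k γ))) e.toMulEquiv

/-- … and conversely: if `k[A]` is a field then `m_A` is irreducible (`k[x]/(m_A)` is a field only for `m_A` prime).
[cite: BrickmanFillmore1967, Lemma 3 (a) (p. 813), Thm. 6 (p. 817: «`K` is a field»)] -/
theorem irreducible_minpoly_of_isField_adjoin_singleton (h : IsField (Algebra.adjoin k ({γ} : Set (Module.End k V)))) :
    Irreducible (minpoly k γ) := by
  obtain ⟨e⟩ := nonempty_adjoin_singleton_algEquiv_adjoinRoot_minpoly γ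
  have hF : IsField (AdjoinRoot (minpoly k γ)) := MulEquiv.isField h e.symm.toMulEquiv
  have hmax : (Ideal.span {minpoly k γ}).IsMaximal := (Ideal.Quotient.maximal_ideal_iff_isField_quotient _).2 hF
  have hμ0 : minpoly k γ ≠ 0 := minpoly.ne_zero (Algebra.IsIntegral.isIntegral γ)
  exact ((Ideal.span_singleton_prime hμ0).1 hmax.isPrime).irreducible

/-- **`k[A]` is a field iff `m_A` is irreducible.** [cite: BrickmanFillmore1967, Lemma 3 (a) (p. 813)] -/
theorem isField_adjoin_singleton_iff_irreducible_minpoly :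
    IsField (Algebra.adjoin k ({γ} : Set (Module.End k V))) ↔ Irreducible (minpoly k γ) :=
  ⟨irreducible_minpoly_of_isField_adjoin_singleton γ, isField_adjoin_singleton_of_irreducible_minpoly γ⟩

end FieldOfPolynomials

end Literature.LinearAlgebra
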